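import Mathlib
import Summits.ValiantsHypothesis.ValiantsHypothesis.Theorems.NewtonTauWeak.Negative.Zonogon
import Summits.ValiantsHypothesis.ValiantsHypothesis.Theorems.NewtonUnitEquationsNewtonTauWeakWeightedNormalForm
import Summits.ValiantsHypothesis.ValiantsHypothesis.Theorems.NewtonUnitEquationsNewtonTauWeakWeightedLevelSetHull
import Summits.ValiantsHypothesis.ValiantsHypothesis.Theorems.NewtonUnitEquationsNewtonTauWeakGradedDesignT2
import Summits.ValiantsHypothesis.ValiantsHypothesis.Theorems.NewtonUnitEquationsNewtonTauWeakResidueWeightedNormalForm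
import Summits.ValiantsHypothesis.ValiantsHypothesis.Theorems.NewtonUnitEquationsNewtonTauWeakResidueWeightedHull

/-!
# `NewtonUnitEquationsNewtonTauWeakWeightedLevelSetAssembly` — THEOREM W, its graded-design T2 instance, THEOREM G″

Line `binomial-normal-form` of crux `NewtonTauWeak` (stmt-ValiantsHypothesis-5904), lead c6: the unconditional
compositions of the rung stubs `RungC6` registered in `Cruxes/NewtonTauWeak/Lines/binomial_normal_form.lean`.

* `weightedLevelSetHull` (**THEOREM W**).  For items `j : Fin N` with integer weights `1 ≤ g j ≤ c` and ARBITRARY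
  exponents `d j ∈ ℕ²` (coincidences allowed), the ℤ-weighted level set of subset sums
  `X_v = {Σ_{j∈J} d j : Σ_{j∈J} g j = v}` has at most `(4N² + 5)(N + 1)(2c + 1)^{2c}` hull vertices — polynomial in
  `N`, uniformly in `v`, for every fixed weight bound `c`.  Composition of the weighted exchange normal form
  `stub_weightedNormalForm` (p-landed, Lagrangian density prefix + zero-sum-free Steinitz correction) with the
  sign-vector count `stub_weightedLevelSetHullOfNF`.
* `gradedDesignT2` (**T2 on graded designs**).  Consequently every GRADED DESIGN
  `f = Σ_{l<K} cf_l Π_{j<N} (1 − u_l^{g j} ρ_j X^{d j})` — any number `K` of products, any nodes `u_l`, any scalars,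
  nonzero `ρ`, dissociated `d` — has `vert f ≤ (Σ_j g j + 1)(4N² + 5)(N + 1)(2c + 1)^{2c}`: the inequality of the open
  stub `stub_binomialNewtonTauCommon` (KPTT Conj. 1 at `t = 2`) on this family with an exponent depending on the
  grade bound `c` only, UNIFORMLY in the number of products (via `stub_gradedDesignT2OfHull`).
* `residueWeightedHull` (**THEOREM G″**).  For nonzero exponents, arbitrary weights `g j`, a modulus `q ≥ 1` and a
  residue `r`, the weighted-residue level set `{Σ_J d : Σ_J g ≡ r (mod q)}` has at most `(4(N² + N) + 5)·q^{2q}`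
  hull vertices (Davenport normal form `stub_residueWeightedNormalForm` + `stub_residueWeightedHullOfNF`): the
  torsion designs with ONE cyclic grading by arbitrary weights are polynomial in `N` at every fixed modulus.

Everything is folklore-level convexity/exchange combinatorics; no named facts, no citations, no `def`s.
-/

-- Sub = Summit single-conjunct layout: the duplicated namespace component is mandated by the tree.
set_option linter.dupNamespace false

noncomputable section

open scoped BigOperators
open MvPolynomial
open Summit.ValiantsHypothesis.ValiantsHypothesis.Theorems.NewtonTauWeak.Negative (vert)

namespace Summit.ValiantsHypothesis.ValiantsHypothesis.Theorems.NewtonUnitEquationsNewtonTauWeak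

/-- **THEOREM W (hull vertices of ℤ-weighted level sets of subset sums).**  For weights `1 ≤ g j ≤ c` and any
exponents `d j ∈ ℕ²`, the convex hull of `{Σ_{j∈J} d j : Σ_{j∈J} g j = v} ⊆ ℝ²` has at most
`(4N² + 5)(N + 1)(2c + 1)^{2c}` extreme points.  Proof: `stub_weightedLevelSetHullOfNF` fed with the normal form
`stub_weightedNormalForm` (rank and canonical-set parameters instantiated by their defining lambda terms). [folklore] -/
theorem weightedLevelSetHull (N c v : ℕ) (g : Fin N → ℕ) (hg : ∀ j, 1 ≤ g j ∧ g j ≤ c)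
    (d : Fin N → (Fin 2 →₀ ℕ)) :
    (Set.extremePoints ℝ (convexHull ℝ ((fun e : Fin 2 →₀ ℕ => fun i : Fin 2 => ((e i : ℕ) : ℝ)) ''
      (((Finset.univ.filter fun J : Finset (Fin N) => ∑ j ∈ J, g j = v).image
        fun J => ∑ j ∈ J, d j : Finset (Fin 2 →₀ ℕ)) : Set (Fin 2 →₀ ℕ))))).ncard ≤
      (4 * (N * N) + 5) * (N + 1) * (2 * c + 1) ^ (2 * c) := by
  refine stub_weightedLevelSetHullOfNF N c v g hg d
    (fun c' j => (Finset.univ.filter fun j' : Fin N =>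
        c' j * (g j' : ℝ) < c' j' * (g j : ℝ) ∨ (c' j' * (g j : ℝ) = c' j * (g j' : ℝ) ∧ j' < j)).card)
    (fun _ _ => rfl) _ (fun _ _ _ _ => rfl) ?_
  intro c' J hJ hmax
  exact stub_weightedNormalForm N c v g hg c' J hJ hmax _ (fun _ => rfl) _ (fun _ _ _ => rfl)

/-- **T2 on GRADED DESIGNS, uniformly in the number of products.**  On a dissociated exponent list `d` with nonzero
coefficients `ρ j` and integer grades `1 ≤ g j ≤ c`, the design `Σ_{l<K} cf_l Π_j (1 − u_l^{g j} ρ_j X^{d j})` (any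
`K`, `u`, `cf`) has at most `(Σ_j g j + 1)(4N² + 5)(N + 1)(2c + 1)^{2c}` Newton vertices: its support is a union of
at most `Σ g + 1` weighted level sets (`stub_gradedDesignT2OfHull`), each bounded by THEOREM W. [folklore] -/
theorem gradedDesignT2 (N c K : ℕ) (g : Fin N → ℕ) (hg : ∀ j, 1 ≤ g j ∧ g j ≤ c)
    (u cf : Fin K → ℂ) (ρ : Fin N → ℂ) (hρ : ∀ j, ρ j ≠ 0) (d : Fin N → (Fin 2 →₀ ℕ))
    (hdis : ∀ J J' : Finset (Fin N), ∑ j ∈ J, d j = ∑ j ∈ J', d j → J = J') :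
    vert (∑ l, C (cf l) * ∏ j, (1 - C (u l ^ g j * ρ j) * monomial (d j) 1)) ≤
      (∑ j, g j + 1) * ((4 * (N * N) + 5) * (N + 1) * (2 * c + 1) ^ (2 * c)) :=
  stub_gradedDesignT2OfHull N K _ g u cf ρ hρ d hdis (fun v => weightedLevelSetHull N c v g hg d)

/-- **THEOREM G″ (hull vertices of weighted-residue level sets, fixed modulus).**  For nonzero exponents `d j`, any
weights `g j`, `q ≥ 1` and a residue `r`, the convex hull of `{Σ_{j∈J} d j : Σ_{j∈J} g j ≡ r (mod q)}` has at most
`(4(N² + N) + 5)·q^{2q}` extreme points.  Proof: `stub_residueWeightedHullOfNF` fed with the Davenport normal form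
`stub_residueWeightedNormalForm`. [folklore] -/
theorem residueWeightedHull (N q r : ℕ) (hq : 1 ≤ q) (g : Fin N → ℕ)
    (d : Fin N → (Fin 2 →₀ ℕ)) (hd : ∀ j, d j ≠ 0) :
    (Set.extremePoints ℝ (convexHull ℝ ((fun e : Fin 2 →₀ ℕ => fun i : Fin 2 => ((e i : ℕ) : ℝ)) ''
      (((Finset.univ.filter fun J : Finset (Fin N) => (∑ j ∈ J, g j) % q = r % q).image
        fun J => ∑ j ∈ J, d j : Finset (Fin 2 →₀ ℕ)) : Set (Fin 2 →₀ ℕ))))).ncard ≤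
      (4 * (N * N + N) + 5) * q ^ (2 * q) := by
  refine stub_residueWeightedHullOfNF N q r hq g d hd _ (fun _ _ _ => rfl) ?_
  intro c hc J hJ hmax
  exact stub_residueWeightedNormalForm N q r hq g c hc J hJ hmax _ (fun _ _ => rfl)

end Summit.ValiantsHypothesis.ValiantsHypothesis.Theorems.NewtonUnitEquationsNewtonTauWeak

end
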